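import Summits.HubbardSuperconductivity.HubbardSuperconductivity.Theorems.BalabanIRBirEveryGroundStateSocket
import Literature.Computability.AlgebraicComplexity.SubspaceProjection
import Literature.MathematicalPhysics.QuantumLattice.LTQOProofs

/-!
# Route `BalabanIR`, crux 5 `BirEveryGroundState` (`stmt-HubbardSuperconductivity-2083`):
# Theses-free CLOSERS — the item's body from scalar / simple ground compressions

Companion of `BalabanIRBirEveryGroundStateSocket.lean` and, like it, importing NO route file
(`…Theses.BalabanIR`) and no Theorems module that does (rev-5 MATERIALISATION RULE: a module that
closes the item is imported INTO the route file, so its whole import cone must avoid the route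
file). The route-file-importing helpers `BalabanIRBirEveryGroundState.lean`
(`birEveryGroundState_of_scalarOnGround`) and `BalabanIRBirEveryGroundStateClosures.lean`
(`birEveryGroundState_of_simpleGround`) prove the crux BY NAME modulo a residual genericity
hypothesis, but can never be imported by a closing module; this file re-establishes the same two
reductions STRUCTURALLY — conclusion = the item's body verbatim — through the socket
`birEveryGroundState_structural_of_transfer`, so that a future Theses-free proof `h` of either
residual hypothesis closes the item by the three-line file
`theorem birEveryGroundState_proof : <body> := birEveryGroundState_structural_of_scalarOnGround h`.

* `birEveryGroundState_structural_of_scalarOnGround` — if for every `δ ∈ (0, 1/2)` every open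
  window `(U₁, U₂) ⊂ (0, ∞)` contains a coupling `U` at which, eventually in even `L`, the pair
  structure factor `Δ_d† Δ_d` has SCALAR matrix elements on the sector ground eigenspace
  `E₀(U, L) = szSector N_L 0 ⊓ ker (H - e₀)` of `H = hubbardTorus 2 L 1 U`, then the body of the
  crux holds: at that `U` the window's average bound `c L⁴ · re tr P ≤ re tr (P Δ_d† Δ_d)` is
  carried by SOME normalised ground state (pigeonhole over an orthonormal frame `B` of `E₀`,
  `P = B Bᴴ`, `tr (P A) = Σ_j ⟨b_j, A b_j⟩` — inlined here from Literature's
  `SubspaceProjection` frame calculus), hence, the compression being scalar, by EVERY normalised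
  ground state, and the socket concludes.
* `birEveryGroundState_structural_of_simpleGround` — the special case of eventual ground-state
  UNIQUENESS in the sector (`dim E₀(U, L) = 1`): a one-dimensional compression is scalar.

The residual hypotheses are NOT proved here (no printed source decides them; see the crux's
evidence notes). Kato, *Perturbation Theory for Linear Operators* (1966), Ch. II §6.1 (context);
Tasaki (2020) App. A.2; Scalapino, Phys. Rep. 250 (1995) 329, §2. Everything is folklore; no
definition is introduced.
-/

noncomputable section

namespace Summit.HubbardSuperconductivity.HubbardSuperconductivity.Theorems

open Matrix Finset Filter
open Literature.Probability.LatticeModels Literature.MathematicalPhysics.QuantumLattice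
open Literature.Computability.AlgebraicComplexity
open scoped ComplexOrder

/-- **CLOSER ⇐ scalar ground compressions at a dense set of couplings** (Theses-free form of
`birEveryGroundState_of_scalarOnGround`). Suppose that for every `δ ∈ (0, 1/2)` and every open
window `(U₁, U₂) ⊂ (0, ∞)` there is a coupling `U` in the window at which, eventually in even `L`,
`Δ_d† Δ_d` has scalar matrix elements `⟨w, Δ_d† Δ_d v⟩ = μ ⟨w, v⟩` on the sector ground eigenspace
`E₀(U, L)` of `hubbardTorus 2 L 1 U` (the Kato–Schur genericity bet of the crux, NOT proved). Then
the body of `Theses.BalabanIR.BirEveryGroundState` holds, verbatim: given the window-average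
hypothesis, at that `U` and every large even `L` write the ground projection as `P = B Bᴴ` for an
orthonormal frame `B` of `E₀` (`exists_orthonormalFrame`, `proj_unique`); then
`re tr (P A) = Σ_j re ⟨b_j, A b_j⟩` and `re tr P = dim E₀ ≥ 1` (a normalised ground state exists),
so some column `b_j ∈ E₀` has `c L⁴ ≤ re ⟨b_j, A b_j⟩ = re μ`, which is the expectation of EVERY
normalised ground state; `birEveryGroundState_structural_of_transfer` concludes. Kato (1966) II
§6.1; Tasaki (2020) App. A.2. [folklore] -/
theorem birEveryGroundState_structural_of_scalarOnGround
    (hgen : ∀ δ ∈ Set.Ioo (0:ℝ) (1/2), ∀ U₁ U₂ : ℝ, 0 < U₁ → U₁ < U₂ →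
      ∃ U ∈ Set.Ioo U₁ U₂, ∃ L₀ : ℕ, ∀ (L : ℕ) [NeZero L], L₀ ≤ L → Even L →
        let N : ℕ := 2 * ⌊(1 - δ) * (L : ℝ) ^ 2 / 2⌋₊
        let H := hubbardTorus 2 L 1 U
        let S := szSector (Λ := FermionTorus 2 L) N 0
        let E₀ := S ⊓ Module.End.eigenspace (Matrix.toLin' H) ((H.minEnergyOn S : ℝ) : ℂ)
        ∃ μ : ℂ, ∀ v ∈ E₀, ∀ w ∈ E₀,
          star w ⬝ᵥ ((pairField dWaveFormFactor L)ᴴ * pairField dWaveFormFactor L) *ᵥ v =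
            μ * (star w ⬝ᵥ v)) :
    ∀ (δ U₁ U₂ c : ℝ), δ ∈ Set.Ioo (0:ℝ) (1/2) → 0 < U₁ → U₁ < U₂ → 0 < c → (∀ U ∈ Set.Ioo U₁ U₂, ∃ L₀ : ℕ, ∀ (L : ℕ) [NeZero L], L₀ ≤ L → Even L → let N : ℕ := 2 * ⌊(1 - δ) * (L : ℝ) ^ 2 / 2⌋₊; let H := Literature.MathematicalPhysics.QuantumLattice.hubbardTorus 2 L 1 U; let S := Literature.MathematicalPhysics.QuantumLattice.szSector (Λ := Literature.MathematicalPhysics.QuantumLattice.FermionTorus 2 L) N 0; let E₀ := S ⊓ Module.End.eigenspace (Matrix.toLin' H) ((H.minEnergyOn S : ℝ) : ℂ); let P := Literature.MathematicalPhysics.QuantumLattice.projMatrix (E₀.map (Literature.MathematicalPhysics.QuantumLattice.Fock.toEuclidean (ι := Literature.MathematicalPhysics.QuantumLattice.Orb (Literature.MathematicalPhysics.QuantumLattice.FermionTorus 2 L)) : Literature.MathematicalPhysics.QuantumLattice.Fock (Literature.MathematicalPhysics.QuantumLattice.Orb (Literature.MathematicalPhysics.QuantumLattice.FermionTorus 2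 L)) →ₗ[ℂ] EuclideanSpace ℂ (Finset (Literature.MathematicalPhysics.QuantumLattice.Orb (Literature.MathematicalPhysics.QuantumLattice.FermionTorus 2 L))))); c * (L : ℝ) ^ 4 * P.trace.re ≤ (P * (Matrix.conjTranspose (Literature.MathematicalPhysics.QuantumLattice.pairField Literature.MathematicalPhysics.QuantumLattice.dWaveFormFactor L) * Literature.MathematicalPhysics.QuantumLattice.pairField Literature.MathematicalPhysics.QuantumLattice.dWaveFormFactor L)).trace.re) → ∃ U ∈ Set.Ioo U₁ U₂, ∀ (N : ℕ → ℕ) (ψ : ∀ L, Literature.MathematicalPhysics.QuantumLattice.Fock (Literature.MathematicalPhysics.QuantumLattice.Orb (Literature.MathematicalPhysics.QuantumLattice.FermionTorus 2 L))), (∀ L, Even L → N L = 2 * ⌊(1 - δ) * (L : ℝ) ^ 2 / 2⌋₊ ∧ star (ψ L) ⬝ᵥ ψ L = 1 ∧ Literature.MathematicalPhysics.QuantumLattice.IsGroundStateInSector (Literature.MathematicalPhysics.QuantumLattice.hubbardTorus 2 L 1 U) (N L) 0 (ψ L)) → Literature.Probability.LatticeModels.HasLongRangeOrder (fun k => Literature.Probability.LatticeModels.halfOpenBox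 2 (2 * k)) (fun k => Literature.MathematicalPhysics.QuantumLattice.torusPullback (Literature.MathematicalPhysics.QuantumLattice.pairFieldCorr Literature.MathematicalPhysics.QuantumLattice.dWaveFormFactor ψ) (2 * k)) := by
  refine birEveryGroundState_structural_of_transfer fun δ U₁ U₂ c hδ hU₁ hU₁₂ hc hyp => ?_
  obtain ⟨U, hU, L₁, hL₁⟩ := hgen δ hδ U₁ U₂ hU₁ hU₁₂
  obtain ⟨L₂, hL₂⟩ := hyp U hU
  refine ⟨U, hU, c, hc, max L₁ L₂, fun L _ hL hLe ψ hgs hunit => ?_⟩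
  -- name the objects of side `L`
  set A : Matrix (Finset (Orb (FermionTorus 2 L))) (Finset (Orb (FermionTorus 2 L))) ℂ :=
    (pairField dWaveFormFactor L)ᴴ * pairField dWaveFormFactor L with hA
  set H := hubbardTorus 2 L 1 U with hH
  set S := szSector (Λ := FermionTorus 2 L) (2 * ⌊(1 - δ) * (L : ℝ) ^ 2 / 2⌋₊) 0 with hS
  set E₀ := S ⊓ Module.End.eigenspace (Matrix.toLin' H) ((H.minEnergyOn S : ℝ) : ℂ) with hE₀
  have hscal : ∃ μ : ℂ, ∀ v ∈ E₀, ∀ w ∈ E₀, star w ⬝ᵥ A *ᵥ v = μ * (star w ⬝ᵥ v) :=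
    hL₁ L ((le_max_left _ _).trans hL) hLe
  have havg : c * (L : ℝ) ^ 4 * (projMatrix (E₀.map
      (Fock.toEuclidean (ι := Orb (FermionTorus 2 L)) :
        Fock (Orb (FermionTorus 2 L)) →ₗ[ℂ]
          EuclideanSpace ℂ (Finset (Orb (FermionTorus 2 L)))))).trace.re ≤
      (projMatrix (E₀.map (Fock.toEuclidean (ι := Orb (FermionTorus 2 L)) :
        Fock (Orb (FermionTorus 2 L)) →ₗ[ℂ]
          EuclideanSpace ℂ (Finset (Orb (FermionTorus 2 L))))) * A).trace.re :=
    hL₂ L ((le_max_right _ _).trans hL) hLe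
  -- the Euclidean transport of the route statements IS `(WithLp.linearEquiv 2 ℂ _).symm`
  have hmap : E₀.map (Fock.toEuclidean (ι := Orb (FermionTorus 2 L)) :
      Fock (Orb (FermionTorus 2 L)) →ₗ[ℂ] EuclideanSpace ℂ (Finset (Orb (FermionTorus 2 L)))) =
      E₀.map ((WithLp.linearEquiv 2 ℂ (Finset (Orb (FermionTorus 2 L)) → ℂ)).symm :
        (Finset (Orb (FermionTorus 2 L)) → ℂ) →ₗ[ℂ]
          EuclideanSpace ℂ (Finset (Orb (FermionTorus 2 L)))) := rfl
  rw [hmap] at havg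
  -- the given ground state lies in `E₀`
  have hψE : ψ ∈ E₀ := by
    refine Submodule.mem_inf.mpr ⟨hgs.1, ?_⟩
    rw [Module.End.mem_eigenspace_iff, Matrix.toLin'_apply]
    exact hgs.2.2
  -- an orthonormal frame of `E₀`; the ground projection is `B Bᴴ`
  obtain ⟨k, B, hk, hBB, hcol, hfix⟩ := exists_orthonormalFrame E₀
  have hP : projMatrix (E₀.map ((WithLp.linearEquiv 2 ℂ (Finset (Orb (FermionTorus 2 L)) → ℂ)).symm :
      (Finset (Orb (FermionTorus 2 L)) → ℂ) →ₗ[ℂ]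
        EuclideanSpace ℂ (Finset (Orb (FermionTorus 2 L))))) = B * Bᴴ :=
    proj_unique (projMatrix_isHermitian _) (Matrix.isHermitian_mul_conjTranspose_self B)
      (fun _ hw => projMatrix_map_mulVec_of_mem E₀ hw) (projMatrix_map_mulVec_mem E₀) hfix
      (frame_proj_mulVec_mem hcol)
  -- diagonal entries of `Bᴴ (A B)` are the expectations in the columns, which are unit vectors
  have hdiag : ∀ j : Fin k,
      (Bᴴ * (A * B)) j j = star (fun x => B x j) ⬝ᵥ A *ᵥ (fun x => B x j) := by
    intro j
    simp only [Matrix.mul_apply, Matrix.conjTranspose_apply, dotProduct, Matrix.mulVec,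
      Pi.star_apply]
  have hunitB : ∀ j : Fin k, star (fun x => B x j) ⬝ᵥ (fun x => B x j) = 1 := by
    intro j
    have := congrFun (congrFun hBB j) j
    simpa [Matrix.mul_apply, Matrix.conjTranspose_apply, dotProduct, Matrix.one_apply] using this
  -- `E₀ ≠ ⊥` (it contains the unit vector `ψ`), so the frame is not empty
  have hkpos : 0 < k := by
    rw [hk]
    refine Submodule.one_le_finrank_iff.mpr ((Submodule.ne_bot_iff _).mpr ⟨ψ, hψE, ?_⟩)
    rintro rfl
    simp at hunit
  -- pigeonhole over the frame: some column carries the average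
  rw [hP, frame_proj_trace hBB, Matrix.mul_assoc, Matrix.trace_mul_comm, Matrix.mul_assoc,
    Matrix.trace] at havg
  simp only [Matrix.diag_apply, Complex.re_sum, Complex.natCast_re] at havg
  have hsum : ∑ _j : Fin k, c * (L : ℝ) ^ 4 ≤ ∑ j : Fin k, ((Bᴴ * (A * B)) j j).re := by
    simpa [mul_comm] using havg
  haveI : Nonempty (Fin k) := ⟨⟨0, hkpos⟩⟩
  obtain ⟨j, -, hj⟩ := Finset.exists_le_of_sum_le Finset.univ_nonempty hsum
  rw [hdiag] at hj
  -- the compression is scalar: `ψ` has the same expectation as the good column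
  obtain ⟨μ, hμ⟩ := hscal
  rw [hμ _ (hcol j) _ (hcol j), hunitB, mul_one] at hj
  rw [hμ ψ hψE ψ hψE, hunit, mul_one]
  exact hj

/-- **CLOSER ⇐ eventual ground-state uniqueness at a dense set of couplings** (Theses-free form
of `birEveryGroundState_of_simpleGround`). If for every `δ ∈ (0, 1/2)` every open window
`(U₁, U₂) ⊂ (0, ∞)` contains a coupling `U` at which, eventually in even `L`, the sector ground
eigenspace `E₀(U, L)` of `hubbardTorus 2 L 1 U` is ONE-dimensional (a non-degenerate sector ground
state — e.g. a unique ground state of total spin `0`, whose `S^z = 0` component is all of it), then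
the body of `Theses.BalabanIR.BirEveryGroundState` holds: on a line `ℂ e` every matrix has scalar
matrix elements (`⟨b e, A (a e)⟩ = (⟨e, A e⟩/⟨e, e⟩) ⟨b e, a e⟩`), and
`birEveryGroundState_structural_of_scalarOnGround` applies. The uniqueness hypothesis is NOT
proved (for the doped repulsive model no uniqueness theorem is known; Lieb, PRL 62 (1989) 1201
covers the attractive and the half-filled repulsive cases only). [folklore] -/
theorem birEveryGroundState_structural_of_simpleGround
    (hsimple : ∀ δ ∈ Set.Ioo (0:ℝ) (1/2), ∀ U₁ U₂ : ℝ, 0 < U₁ → U₁ < U₂ →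
      ∃ U ∈ Set.Ioo U₁ U₂, ∃ L₀ : ℕ, ∀ (L : ℕ) [NeZero L], L₀ ≤ L → Even L →
        let N : ℕ := 2 * ⌊(1 - δ) * (L : ℝ) ^ 2 / 2⌋₊
        let H := hubbardTorus 2 L 1 U
        let S := szSector (Λ := FermionTorus 2 L) N 0
        let E₀ := S ⊓ Module.End.eigenspace (Matrix.toLin' H) ((H.minEnergyOn S : ℝ) : ℂ)
        Module.finrank ℂ E₀ = 1) :
    ∀ (δ U₁ U₂ c : ℝ), δ ∈ Set.Ioo (0:ℝ) (1/2) → 0 < U₁ → U₁ < U₂ → 0 < c → (∀ U ∈ Set.Ioo U₁ U₂, ∃ L₀ : ℕ, ∀ (L : ℕ) [NeZero L], L₀ ≤ L → Even L → let N : ℕ := 2 * ⌊(1 - δ) * (L : ℝ) ^ 2 / 2⌋₊; let H := Literature.MathematicalPhysics.QuantumLattice.hubbardTorus 2 L 1 U; let S := Literature.MathematicalPhysics.QuantumLattice.szSector (Λ := Literature.MathematicalPhysics.QuantumLattice.FermionTorus 2 L) N 0; let E₀ := S ⊓ Module.End.eigenspace (Matrix.toLin' H) ((H.minEnergyOn S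 : ℝ) : ℂ); let P := Literature.MathematicalPhysics.QuantumLattice.projMatrix (E₀.map (Literature.MathematicalPhysics.QuantumLattice.Fock.toEuclidean (ι := Literature.MathematicalPhysics.QuantumLattice.Orb (Literature.MathematicalPhysics.QuantumLattice.FermionTorus 2 L)) : Literature.MathematicalPhysics.QuantumLattice.Fock (Literature.MathematicalPhysics.QuantumLattice.Orb (Literature.MathematicalPhysics.QuantumLattice.FermionTorus 2 L)) →ₗ[ℂ] EuclideanSpace ℂ (Finset (Literature.MathematicalPhysics.QuantumLattice.Orb (Literature.MathematicalPhysics.QuantumLattice.FermionTorus 2 L))))); c * (L : ℝ) ^ 4 * P.trace.re ≤ (P * (Matrix.conjTranspose (Literature.MathematicalPhysics.QuantumLattice.pairField Literature.MathematicalPhysics.QuantumLattice.dWaveFormFactor L) * Literature.MathematicalPhysics.QuantumLattice.pairField Literature.MathematicalPhysics.QuantumLattice.dWaveFormFactor L)).trace.re) → ∃ U ∈ Set.Ioo U₁ U₂, ∀ (N : ℕ → ℕ) (ψ : ∀ L, Literature.MathematicalPhysics.QuantumLattice.Fock (Literature.MathematicalPhysics.QuantumLattice.Orb (Literature.MathematicalPhysics.QuantumLattice.FermionTorus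 2 L))), (∀ L, Even L → N L = 2 * ⌊(1 - δ) * (L : ℝ) ^ 2 / 2⌋₊ ∧ star (ψ L) ⬝ᵥ ψ L = 1 ∧ Literature.MathematicalPhysics.QuantumLattice.IsGroundStateInSector (Literature.MathematicalPhysics.QuantumLattice.hubbardTorus 2 L 1 U) (N L) 0 (ψ L)) → Literature.Probability.LatticeModels.HasLongRangeOrder (fun k => Literature.Probability.LatticeModels.halfOpenBox 2 (2 * k)) (fun k => Literature.MathematicalPhysics.QuantumLattice.torusPullback (Literature.MathematicalPhysics.QuantumLattice.pairFieldCorr Literature.MathematicalPhysics.QuantumLattice.dWaveFormFactor ψ) (2 * k)) := by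
  refine birEveryGroundState_structural_of_scalarOnGround fun δ hδ U₁ U₂ hU₁ hU₁₂ => ?_
  obtain ⟨U, hU, L₀, hL₀⟩ := hsimple δ hδ U₁ U₂ hU₁ hU₁₂
  refine ⟨U, hU, L₀, fun L _ hL hLe => ?_⟩
  -- name the objects of side `L`
  set A : Matrix (Finset (Orb (FermionTorus 2 L))) (Finset (Orb (FermionTorus 2 L))) ℂ :=
    (pairField dWaveFormFactor L)ᴴ * pairField dWaveFormFactor L with hA
  set H := hubbardTorus 2 L 1 U with hH
  set S := szSector (Λ := FermionTorus 2 L) (2 * ⌊(1 - δ) * (L : ℝ) ^ 2 / 2⌋₊) 0 with hS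
  set E₀ := S ⊓ Module.End.eigenspace (Matrix.toLin' H) ((H.minEnergyOn S : ℝ) : ℂ) with hE₀
  have h1 : Module.finrank ℂ E₀ = 1 := hL₀ L hL hLe
  show ∃ μ : ℂ, ∀ v ∈ E₀, ∀ w ∈ E₀, star w ⬝ᵥ A *ᵥ v = μ * (star w ⬝ᵥ v)
  -- a generator `e` of the line `E₀`
  obtain ⟨e, he0, hspan⟩ := (finrank_eq_one_iff' (K := ℂ) (V := E₀)).mp h1
  refine ⟨(star (e : Fock (Orb (FermionTorus 2 L))) ⬝ᵥ A *ᵥ (e : Fock (Orb (FermionTorus 2 L)))) /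
    (star (e : Fock (Orb (FermionTorus 2 L))) ⬝ᵥ (e : Fock (Orb (FermionTorus 2 L)))),
    fun v hv w hw => ?_⟩
  have he0' : star (e : Fock (Orb (FermionTorus 2 L))) ⬝ᵥ (e : Fock (Orb (FermionTorus 2 L))) ≠ 0 :=
    fun h0 => he0 (Subtype.ext (dotProduct_star_self_eq_zero.mp h0))
  obtain ⟨a, ha⟩ := hspan ⟨v, hv⟩
  obtain ⟨b, hb⟩ := hspan ⟨w, hw⟩
  have hav : v = a • (e : Fock (Orb (FermionTorus 2 L))) := by
    simpa using congrArg Subtype.val ha.symm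
  have hbw : w = b • (e : Fock (Orb (FermionTorus 2 L))) := by
    simpa using congrArg Subtype.val hb.symm
  rw [hav, hbw, star_smul, mulVec_smul, dotProduct_smul, smul_dotProduct, smul_dotProduct,
    dotProduct_smul]
  simp only [smul_eq_mul]
  field_simp

end Summit.HubbardSuperconductivity.HubbardSuperconductivity.Theorems
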